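import Summits.QuantumFields.YangMills.Theorems.BalabanUVNodesN16DialScalingCertificate
import Summits.QuantumFields.YangMills.Theorems.BalabanUVNodesN16EntrySqueezeJunction
import Summits.QuantumFields.YangMills.Theorems.BalabanUVNodesN16Stage3OfFamilyMat

/-!
# Route «BalabanUVNodes», crux K3⁸ `SpineGivenEndpointR13SepCoPHV` (stmt-QuantumFields-27366), node N16 = NE3 — THE TUNED-WITNESS FACE: N16's CARRIABLE SENTENCE AT PIN v7,
# `N16DialScaling.WitnessDialN16 β` (∃ admissible dial `(ℓ₃, g, B)` with THE END's rows + the radius match such that EVERY reading pinned loose there satisfies N16's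
# conjunct at every Stage-13 tuple and run length), BY NAME from the two displayed in-edges — node N16's chain-entry object `hE` (or node N05's Σ-object `hN05` at
# `stage3OfFamilyMat F 2`) and node N07's Reg910 slot key — and what the stub-1 closer gets from it at any v4-guarded reading

Cell `pub-ymgap`, seat `pub-ymgap-dag-n16-e` (R134 acceleration seat (a), strategy s2 = BY-NAME KNIT at the record; HUMAN RULING D-0062; chair R424 venue), generation 29,
module 61 (THEOREMS ONLY, 0 `def`, 0 `sorry`, standard axioms).  `--kind proof --supports stmt-QuantumFields-27366 --as helper` (count-neutral; proves NO registered stub).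
`bears_on: R4∕N16 · edges N05 → N16, N07 → N16`.  Over module 60 `…N16DialScalingCertificate` (✓p776216: `WitnessDialN16`, `repin`, `guardedReading_repin`), module 59b
`…N16EntrySqueezeJunction` (✓p689699: the loose reading-level producer from `hE` + slot key) and module 58 `…N16Stage3OfFamilyMat` (✓p688784: `hN05 → hE`).

WHY (HOME `LOCATED-N16-TUNED-WITNESS.md` ada107390ee7562e, evidence #43 on 27366).  Module 60 certifies that the corner-free ∀-dial sentence of STANDING RULE NE-PIN №239 (4)(ii)
is void for N16 at the registered pin (Λ₂'-scaling) and names the sentence N16 CAN carry: `WitnessDialN16 β`.  THIS MODULE states that sentence BY NAME from the displayed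
in-edges, in both currencies of record, so that a booking line (if the director admits the tuned-witness class) or the stub-1 closer (otherwise) cites ONE theorem:
§1 ★★ `witnessDialN16_of_entry_reg910Slot` (from `hE` + slot key; `β ≤ 1`) · ★★ `witnessDialN16_of_n05UniformP_reg910Slot` (from `hN05` + slot key; `0 ≤ β ≤ 1`);
§2 ★ `exists_guardedReadingN16_of_witnessDial` — from `WitnessDialN16 β` and ANY v4-guarded reading `𝔯` (`GuardedReading 𝔯 ksel ℓ`: the N14 ∕ N15 ∕ U3 pins + keyed liveness,
other lanes' objects), the re-pinned reading `repin 𝔯 ℓ₃ B` carries the FULL registered pin `GuardedReadingN16` AND N16's conjunct at every tuple and run length — stub 1's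
three N16 conjuncts and N16's share of `KeyedRatesHolderD4V`'s rates row, jointly inhabited relative to the v4 guard (the A2 sentence for N16's rows).

HONEST FRAMING.  Composition BY NAME (two `obtain`s and an anonymous constructor); no estimate.  `hE` ∕ `hN05` (node N05's [Balaban1985RegularSpaces] Thm 4 ∕ Prop 3 bodies —
N05∕N06 content, inhabited by p681888 only GIVEN node N06's per-period binders) and the slot key (node N07 — [Balaban1985Variational] Thm 1 (9)–(10)) are DISPLAYED
hypotheses asserted for no family; no stub of K3⁸ v7 closed or claimed; N16 ∕ N05 ∕ N06 ∕ N07 NOT discharged; counts UNMOVED (typed 28∕28 · discharged 8∕27 · A 8∕28).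
One finite four-torus at fixed `ε`, Bałaban AS PRINTED — NOT ℝ⁴, NOT infinite volume, NOT OS, NOT a mass gap; the YM mass gap (Clay) is NOT proved by any of this.
References: [Balaban1985RegularSpaces] T. Bałaban, CMP **99** (1985) 75–102, Thm 4 p. 88, (1.36) p. 82; [Balaban1985Variational] T. Bałaban, CMP **102** (1985) 277–309, Thm 1 p. 279.
-/

set_option autoImplicit false

namespace Summit.QuantumFields.YangMills.BalabanUVNodes.N16WitnessDialFace

open scoped BigOperators Matrix Matrix.Norms.L2Operator
open NormedSpace

open Literature.MathematicalPhysics.QuantumFieldTheory.Balaban1983to89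
open Literature.MathematicalPhysics.QuantumFieldTheory.Balaban1983to89.T4Continuum (T4Family ULoop)
open B7Prop1Explicit B7Prop2Explicit MatrixLog UnitaryModel
open T4AveragingDeficitWall hiding Site Plane Plaq Bond
open B7Eq92Concrete (mgauge)
open B8Ineq132 (covDerivFwd)
open B8Eq184Proof (cfgExp)
open B8Eq119TwistedAxial (Restr129)
open B8Eq138LandauZd (covLap IsLandau138)
open B8Thm4TorusAt (torusLam Thm4TorusAt)
open B8LeafModelZdHP2Per (zdGF3HP₂Per)
open Node00 (Stage13HParams IdxB8SubDPerκ NE3Objects₁₁ NE3Letters₁₁ ne3ConstLayerOfRecord₁₁ ne3NperOfRecord₁₁ ne3DomOfRecord₁₁ one_le_ne3NperOfRecord₁₁ MatA)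
open Summit.QuantumFields.BalabanUV.T4Continuum
open MinimalActionSandwich (IsMinimiser admissible)
open MinimalActionRate (sfClass)
open MinimalActionRefine (gradConst)
open MinimalActionDictionary (torusVP RadiiMono)
open AveragingDeficitLatticeH2Prep (fd)
open B11 (Regularity)
open YMDAG.UVSplit (ne3OfRecord₁₁ RateReading₁₃CoPH rateCarriersOfRecord₁₃CoPH)
open Summit.QuantumFields.YangMills.BalabanUVNodes.N16HolderDefs (N16HolderAt)
open Summit.QuantumFields.YangMills.BalabanUVNodes.N16PinnedLayer13CoPH (N16PinnedLoose N16LettersEnd N16HolderAtReading)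
open Summit.QuantumFields.YangMills.BalabanUVNodes.N16EntrySqueezeJunction (exists_letters_n16HolderAtReading_loose_squeezeJunction_of_entry_reg910Slot)
open Summit.QuantumFields.YangMills.BalabanUVNodes.N16Stage3OfFamilyMat (stage3OfFamilyMat exists_entry_of_n05UniformP)
open Summit.QuantumFields.YangMills.BalabanUVNodes.N16DialScaling (WitnessDialN16 repin guardedReading_repin n16PinnedLoose_repin)
open Summit.QuantumFields.YangMills.Theorems.K3V5Defs (RunSel LetterReading GuardedReading GuardedReadingN16 N16RadiusMatch)

noncomputable section

variable {β : ℝ}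

/-! ## §1 ★★ N16's carriable sentence from the displayed in-edges, both currencies -/

/-- **★★ THE TUNED-WITNESS FACE FROM NODE N16's CHAIN-ENTRY OBJECT AND THE SLOT KEY** (`β ≤ 1`): from `hE` ([Balaban1985RegularSpaces] Theorem 4 in the all-torus geometry at every
level with the print conclusion slot at Hölder exponent `β`, θ-free — module 57's object) and node N07's Reg910 slot key (`G hGm hG C hR`, module 47∕49∕50's binders at `N = 2`):
`WitnessDialN16 β` — SOME admissible dial `(ℓ₃, g, B)` (here `g := gradConst 4 ∘ c'`, module 59b's tuned letters) such that EVERY reading pinned loose there satisfies N16's conjunct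
at every Stage-13 tuple with core provisos, every `g₀`, `os`, every run length.  Module 59b §2 projected. [cite: Balaban1985Variational, Thm 1 (9)–(10) p.279] [folklore] -/
theorem witnessDialN16_of_entry_reg910Slot (hβ1 : β ≤ 1)
    (hE : ∀ F : T4Family, ∃ B Bh c₁' : ℝ, 0 < B ∧ 0 < c₁' ∧ 16 * (B * c₁') ≤ 1 ∧
      ∀ k, 1 ≤ k → Thm4TorusAt F.L k (((ne3NperOfRecord₁₁ F 0 0 * F.L ^ k : ℕ) : ℤ)) (((F.L : ℝ) ^ k)⁻¹) c₁' (unitaryUnits (Matrix (Fin 2) (Fin 2) ℂ))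
        (fun _ => True) (Restr129 F.L k (torusLam k))
        (fun (α₀ α₁ : ℝ) (U₀ U' : Site 4 → Fin 4 → (Matrix (Fin 2) (Fin 2) ℂ)ˣ) (u : Site 4 → (Matrix (Fin 2) (Fin 2) ℂ)ˣ) =>
          ∃ A : Site 4 → Fin 4 → Matrix (Fin 2) (Fin 2) ℂ,
            (∀ x μ, IsSelfAdjoint (A x μ)) ∧ (∀ (x : Site 4) (κ μ : Fin 4), A (x + (((ne3NperOfRecord₁₁ F 0 0 * F.L ^ k : ℕ) : ℤ)) • e κ) μ = A x μ) ∧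
            mgauge U₀ u (cfgExp (((F.L : ℝ) ^ k)⁻¹) A) = U' ∧
            (∀ x μ, ‖A x μ‖ ≤ B * (α₀ + α₁)) ∧
            (∀ (μ : Fin 4) (x : Site 4) (κ : Fin 4), ‖covDerivFwd (((F.L : ℝ) ^ k)⁻¹) U₀ μ (fun z => A z κ) x‖ ≤ B * (α₀ + α₁)) ∧
            IsLandau138 F.L k (((F.L : ℝ) ^ k)⁻¹) Set.univ (torusLam k) U₀ A ∧
            (∀ (μ : Fin 4) (y : Site 4) (κ : Fin 4),
              ‖Ad (U₀ y μ) (covDerivFwd (((F.L : ℝ) ^ k)⁻¹) U₀ μ (fun z => A z κ) (y + e μ)) - covDerivFwd (((F.L : ℝ) ^ k)⁻¹) U₀ μ (fun z => A z κ) y‖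
                ≤ Bh * (α₀ + α₁) * (((F.L : ℝ)⁻¹) ^ k) ^ β) ∧
            (∀ (x : Site 4) (κ : Fin 4), ‖covLap (((F.L : ℝ) ^ k)⁻¹) U₀ (fun z => A z κ) x‖ ≤ B * (α₀ + α₁))))
    {G : T4Family → (Site 4 → Fin 4 → (MatA 2)ˣ) → Site 4 → ℕ → ℝ → ℝ → ℝ → Prop} (hGm : ∀ F, RadiiMono 4 (G F))
    (hG : ∀ (F : T4Family) (U : Site 4 → Fin 4 → (MatA 2)ˣ) (x : Site 4) (K : ℕ) (α₀ α₁ α₂ : ℝ), 2 ≤ K → G F U x K α₀ α₁ α₂ →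
      ∃ (u : Site 4 → (MatA 2)ˣ) (a : Site 4 → Fin 4 → MatA 2),
        (∀ z, u z ∈ unitaryUnits (MatA 2)) ∧
        (∀ (y : Site 4) (τ : Fin 4), l1 (y - x) ≤ 2 → ((gaugeAct u U y τ : (MatA 2)ˣ) : MatA 2) = exp (a y τ)) ∧
        (∀ (y : Site 4) (τ : Fin 4), l1 (y - x) ≤ 2 → ‖a y τ‖ ≤ α₀) ∧
        (∀ (y : Site 4) (τ i : Fin 4), l1 (y - x) ≤ 1 → ‖fd i (fun z => a z τ) y‖ ≤ α₁) ∧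
        (∀ (τ i l : Fin 4), ‖fd i (fd l (fun z => a z τ)) x‖ ≤ α₂))
    (C : T4Family → B11Thm1.Consts)
    (hR : ∀ (F : T4Family) (k : ℕ) (ε₁ : ℝ), 0 < ε₁ → ε₁ ≤ (C F).a₁ → ∀ (V U : Site 4 → Fin 4 → (MatA 2)ˣ), V ∈ sfClass 4 F.L (ne3NperOfRecord₁₁ F 0 0) ε₁ 0 →
      IsMinimiser 4 (sfClass 4 F.L (ne3NperOfRecord₁₁ F 0 0) ((C F).B₃ * ε₁)) F.L (ne3NperOfRecord₁₁ F 0 0) (k + 1) V U →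
        ∀ x : Site 4, Regularity (torusVP 4 F.L (ne3NperOfRecord₁₁ F 0 0) (G F) (k + 1)) (C F).B₃ (C F).B₄ ε₁ U (x, F.L ^ (k + 1) - 1 + F.L ^ (k + 1) + 2)) :
    WitnessDialN16 β := by
  obtain ⟨ℓ₃, B, c', hend, hmatch, -, -, hread, -⟩ :=
    exists_letters_n16HolderAtReading_loose_squeezeJunction_of_entry_reg910Slot (N := 2) hβ1 hE hGm hG C hR
  exact ⟨ℓ₃, fun F => gradConst 4 (c' F), B, hend, hmatch, hread⟩

/-- **★★ THE TUNED-WITNESS FACE FROM NODE N05's Σ-OBJECT AND THE SLOT KEY** (`0 ≤ β ≤ 1`): `hN05` = p681888's CONCLUSION TEXT at `θ := stage3OfFamilyMat F 2` (period family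
`ν ↦ ne3NperOfRecord₁₁ F 0 0 · F.L^ν`, pins `(Mκ, Rκ)` and the Hölder length letter existential per family, pin equations dropped — module 59g's binder VERBATIM) and the slot key give
`WitnessDialN16 β` (module 58 §2 `exists_entry_of_n05UniformP` ∘ the previous theorem). [cite: Balaban1985RegularSpaces, Thm 4 p.88, Prop. 3 p.87] [folklore] -/
theorem witnessDialN16_of_n05UniformP_reg910Slot (hβ0 : 0 ≤ β) (hβ1 : β ≤ 1)
    (hN05 : ∀ F : T4Family, letI : CStarAlgebra (Matrix (Fin 2) (Fin 2) ℂ) := B10Eq29TubeLine.cstarAlgebraMatrix 2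
      ∃ (Mκ Rκ : ℕ) (len : B7Prop1Explicit.Site 4 → ℝ), (∀ v : B7Prop1Explicit.Site 4, 0 < len v → 1 ≤ len v) ∧ (∀ μ : Fin 4, len (B7Prop1Explicit.e μ) = 1) ∧
      ∃ (inp : B8.B9Inputs) (B₀β B₈ c₄ c₃ : ℝ), inp.B₀ ≤ B₈ ∧ 0 < c₄ ∧ 0 < c₃ ∧
        ∀ (ν : {k : ℕ // 1 ≤ k}) (a : IdxB8SubDPerκ (stage3OfFamilyMat F 2) (ne3NperOfRecord₁₁ F 0 0 * F.L ^ ν.1) Mκ Rκ),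
          B8.Thm4Body c₄ (5 * ((4 : ℕ) : ℝ) * F.L * B₈)
            (fun _ : Unit => (zdGF3HP₂Per (Matrix (Fin 2) (Fin 2) ℂ) F.L β len a.toZdIdx (ne3NperOfRecord₁₁ F 0 0 * F.L ^ ν.1)).toGFData) ∧
          B8.Prop3Body c₃ 4 (F.L : ℝ) (2097152 * (((4 : ℕ) : ℝ) + 1) ^ 2 * (F.L : ℝ) ^ 2) inp B₀β
            (fun _ : Unit => (zdGF3HP₂Per (Matrix (Fin 2) (Fin 2) ℂ) F.L β len a.toZdIdx (ne3NperOfRecord₁₁ F 0 0 * F.L ^ ν.1)).toGFData2))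
    {G : T4Family → (B7Prop1Explicit.Site 4 → Fin 4 → (Node00.MatA 2)ˣ) → B7Prop1Explicit.Site 4 → ℕ → ℝ → ℝ → ℝ → Prop}
    (hGm : ∀ F, MinimalActionDictionary.RadiiMono 4 (G F))
    (hG : ∀ (F : T4Family) (U : B7Prop1Explicit.Site 4 → Fin 4 → (Node00.MatA 2)ˣ) (x : B7Prop1Explicit.Site 4) (K : ℕ) (α₀ α₁ α₂ : ℝ), 2 ≤ K → G F U x K α₀ α₁ α₂ →
      ∃ (u : B7Prop1Explicit.Site 4 → (Node00.MatA 2)ˣ) (a : B7Prop1Explicit.Site 4 → Fin 4 → Node00.MatA 2),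
        (∀ z, u z ∈ B7Prop2Explicit.unitaryUnits (Node00.MatA 2)) ∧
        (∀ (y : B7Prop1Explicit.Site 4) (τ : Fin 4), B7Prop1Explicit.l1 (y - x) ≤ 2 →
          ((B7Prop1Explicit.gaugeAct u U y τ : (Node00.MatA 2)ˣ) : Node00.MatA 2) = NormedSpace.exp (a y τ)) ∧
        (∀ (y : B7Prop1Explicit.Site 4) (τ : Fin 4), B7Prop1Explicit.l1 (y - x) ≤ 2 → ‖a y τ‖ ≤ α₀) ∧
        (∀ (y : B7Prop1Explicit.Site 4) (τ i : Fin 4), B7Prop1Explicit.l1 (y - x) ≤ 1 → ‖AveragingDeficitLatticeH2Prep.fd i (fun z => a z τ) y‖ ≤ α₁) ∧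
        (∀ (τ i l : Fin 4), ‖AveragingDeficitLatticeH2Prep.fd i (AveragingDeficitLatticeH2Prep.fd l (fun z => a z τ)) x‖ ≤ α₂))
    (C : T4Family → B11Thm1.Consts)
    (hR : ∀ (F : T4Family) (k : ℕ) (ε₁ : ℝ), 0 < ε₁ → ε₁ ≤ (C F).a₁ → ∀ (V U : B7Prop1Explicit.Site 4 → Fin 4 → (Node00.MatA 2)ˣ),
      V ∈ sfClass 4 F.L (ne3NperOfRecord₁₁ F 0 0) ε₁ 0 →
      IsMinimiser 4 (sfClass 4 F.L (ne3NperOfRecord₁₁ F 0 0) ((C F).B₃ * ε₁)) F.L (ne3NperOfRecord₁₁ F 0 0) (k + 1) V U →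
        ∀ x : B7Prop1Explicit.Site 4, B11.Regularity (MinimalActionDictionary.torusVP 4 F.L (ne3NperOfRecord₁₁ F 0 0) (G F) (k + 1)) (C F).B₃ (C F).B₄ ε₁ U
          (x, F.L ^ (k + 1) - 1 + F.L ^ (k + 1) + 2)) :
    WitnessDialN16 β :=
  witnessDialN16_of_entry_reg910Slot hβ1
    (fun F => by
      obtain ⟨Mκ, Rκ, len, hlen, hlen1, h⟩ := hN05 F
      exact exists_entry_of_n05UniformP F 2 (one_le_ne3NperOfRecord₁₁ F 0 0) Mκ Rκ hβ0 hlen hlen1 h)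
    hGm hG C hR

/-! ## §2 ★ What the stub-1 closer gets: the registered pin AND N16's conjunct at the re-pinned reading, from any v4-guarded reading -/

/-- **★ N16's ROWS OF STUB 1 AT THE WITNESSED DIAL, FROM ANY v4-GUARDED READING**: given `WitnessDialN16 β` and a reading `𝔯` carrying the v4 guard `GuardedReading 𝔯 ksel ℓ` (N14 pin,
keyed N15 liveness, (α-N15) pin, node-U3 pin — the other lanes' objects), there is a dial `(ℓ₃, g, B)` such that the re-pinned reading `repin 𝔯 ℓ₃ B` (module 60: `𝔯` with its NE3
layer re-pinned loose at `(ℓ₃, B)`, N14 ∕ N15 ∕ U3 layers untouched) carries the FULL registered pin `GuardedReadingN16` AND N16's conjunct at every Stage-13 tuple with core provisos and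
every run length — stub 1's N16 share jointly inhabited relative to the v4 guard. [bookkeeping] -/
theorem exists_guardedReadingN16_of_witnessDial (h : WitnessDialN16 β) {𝔯 : RateReading₁₃CoPH 2} {ksel : RunSel} {ℓ : LetterReading}
    (h𝔯 : GuardedReading 𝔯 ksel ℓ) :
    ∃ (ℓ₃ : T4Family → NE3Letters₁₁) (g B : T4Family → ℝ),
      GuardedReadingN16 (repin 𝔯 ℓ₃ B) ksel ℓ ℓ₃ g B ∧ N16HolderAtReading (repin 𝔯 ℓ₃ B) β := by
  obtain ⟨ℓ₃, g, B, hend, hmatch, hread⟩ := h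
  exact ⟨ℓ₃, g, B, ⟨guardedReading_repin h𝔯 _ _, n16PinnedLoose_repin 𝔯 _ B, hend, hmatch⟩, hread _ (n16PinnedLoose_repin 𝔯 _ B)⟩

/-- **… hence N16's conjunct of the rates row at the selected bundles** — `N16HolderAt (rateCarriersOfRecord₁₃CoPH (repin 𝔯 ℓ₃ B) F θ hP g₀ os (ksel F θ hP g₀ os)).ne3 β` at every
tuple, the shape the K3⁸ bill's `h16` face consumes (`K3V5Defs.keyedRatesHolderD4_rrOfRecord_of_pins_of_letters`). [bookkeeping] -/
theorem exists_pin_n16HolderAt_rrOfRecord_of_witnessDial (h : WitnessDialN16 β) {𝔯 : RateReading₁₃CoPH 2} {ksel : RunSel} {ℓ : LetterReading}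
    (h𝔯 : GuardedReading 𝔯 ksel ℓ) :
    ∃ (ℓ₃ : T4Family → NE3Letters₁₁) (g B : T4Family → ℝ), GuardedReadingN16 (repin 𝔯 ℓ₃ B) ksel ℓ ℓ₃ g B ∧
      ∀ (F : T4Family) (θ : Stage13HParams F 2) (hP : θ.Provisos₁₃CoPH F 2) (g₀ : ℕ → ℝ) (os : List (ULoop F)),
        N16HolderAt (rateCarriersOfRecord₁₃CoPH (repin 𝔯 ℓ₃ B) F θ hP g₀ os (ksel F θ hP g₀ os)).ne3 β := by
  obtain ⟨ℓ₃, g, B, hG, hread⟩ := exists_guardedReadingN16_of_witnessDial h h𝔯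
  exact ⟨ℓ₃, g, B, hG, fun F θ hP g₀ os => hread F θ hP g₀ os _⟩

end

end Summit.QuantumFields.YangMills.BalabanUVNodes.N16WitnessDialFace
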